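import Summits.Ventures.YMGap.RobustBall.PeriodisedBox
import Summits.Ventures.YMGap.RobustBall.LatticeSumL1
import Summits.Ventures.YMGap.RobustBall.OneStateInvariant
import Summits.Ventures.YMGap.Thresholds.PlaquetteSusceptibility
import Summits.Ventures.YMGap.Thresholds.MassGapAtMassive
import Mathlib.MeasureTheory.OuterMeasure.BorelCantelli
import Mathlib.Analysis.PSeries
import HarnessLib

/-!
# Venture YMGap, track ROBUST-BALL — ERGODIC AVERAGES ALONG CUBES: for a translation-invariant state with absolutely summable
# autocovariances, the cube averages of a bounded observable converge to its mean in `L²` (rate `1/#B_n`) and ALMOST SURELY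

HONEST FRAMING. WHAT THIS IS: a venture file (cell `pub-ymgap`, track Y2 ROBUST-BALL, seat ds-3, theorems only). The cell's
one-state rows say the DLR state is unique, translation invariant and (g12's `OneStateTailTrivial`) tail trivial / ergodic; its
concentration rows (C-CONC) bound deviation probabilities of spatial averages. None gives an ALMOST-SURE convergence statement for
spatial averages (Mathlib has no pointwise ergodic theorem for `ℤ^d`-actions). This file proves the quantitative mean and almost-sure
ergodic theorem along the centred cubes `B_n = siteBox d n` for ANY translation-invariant probability measure `μ` on the `ℤ^d` link
configurations and ANY bounded measurable `f` whose autocovariance `c(v) = cov_μ(f, f∘θ_v)` is absolutely summable: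

* `integral_comp_shift` — `∫ f∘θ_x dμ = ∫ f dμ`; `variance_boxSum_le` — `Var_μ(Σ_{x∈B} f∘θ_x) ≤ #B · Σ_v |c(v)|` for EVERY finite `B`;
* ★ `measure_abs_boxAverage_sub_ge_le` — Chebyshev: `μ{|#B⁻¹ Σ_{x∈B} f∘θ_x − ∫ f dμ| ≥ ε} ≤ Σ_v|c(v)| / (ε² #B)` (every finite
  nonempty `B` — cubes, slabs, sponges);
* ★★ `ae_tendsto_boxAverage` — for `d ≥ 2`: `#B_n⁻¹ Σ_{x∈B_n} f(θ_x U) → ∫ f dμ` for `μ`-almost every configuration `U`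
  (Chebyshev + `Σ_n (2n+1)^{−d} < ∞` + Borel–Cantelli; `d ≥ 2` is where the second-moment route suffices);
* ★★ CELL `su2_wilson_ae_tendsto_boxAverage` — `SU(2)` lattice Yang–Mills on `ℤ⁴` at every `|β_W| ≤ 9/25` (tree coupling `b`,
  `|b| ≤ 9/50`, the vertex-star window): the unique DLR state is translation invariant and massive, so EVERY bounded measurable
  gauge-invariant local observable is self-averaging ALMOST SURELY and in `L²` along cubes — e.g. the plaquette: the empirical mean
  plaquette of a single infinite-volume sample over the cube `B_n` converges to `⟨W_p⟩` with probability one.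
WHAT THIS IS NOT: not a statement about finite-volume simulations with boundary (see the kernel rows), not a CLT, not a large-deviation
rate (C-CONC gives exponential tails inside the single-link doors; here only absolutely summable autocovariances are assumed, which
holds in the whole star window); lattice; nothing about the continuum or the Clay problem.

References: B. Simon, *The Statistical Mechanics of Lattice Gases* I (1993), §II.12, §III.1; H.-O. Georgii, *Gibbs Measures and Phase
Transitions* (2011), Ch. 14 (ergodic theorems for Gibbs measures); Mathlib `meas_ge_le_variance_div_sq`, `ae_eventually_notMem`.
-/

noncomputable section

open MeasureTheory Filter Function ProbabilityTheory Real Topology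
open scoped NNReal ENNReal
open Literature.Probability.LatticeModels hiding configShift configShift_apply
open Literature.MathematicalPhysics.QuantumLattice
open Literature.MathematicalPhysics.QuantumFieldTheory hiding ZdEdge Site IsLocalObservable
open Literature.Barriers.QuantumFields (IsMassiveState)
open Literature.Probability.LatticeModels.DobrushinMetric (integrable_of_abs_le')
open Summit.Ventures.YMGap.PlaquetteSusceptibility (l1_le_mul_norm)

namespace Summit.Ventures.YMGap.RobustBall

namespace ErgodicAverages

variable {d : ℕ} {G : Type*} [MeasurableSpace G]

/-! ### Means and variances of cube sums under a translation-invariant state -/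

/-- `∫ f∘θ_x dμ = ∫ f dμ` for a translation-invariant `μ`. [folklore] -/
theorem integral_comp_shift {μ : Measure (LGConfig d G)} (hμ : IsZdTranslationInvariant μ) (f : LGConfig d G → ℝ)
    (x : Site d) : ∫ U, f (configShift x U) ∂μ = ∫ U, f U ∂μ := by
  rw [← integral_map_equiv (configShift x) f, hμ x]

/-- **Variance of a block sum, upper bound**: for a translation-invariant probability measure, a bounded measurable `f` with
absolutely summable autocovariance and EVERY finite set `B` of sites: `Var_μ(Σ_{x∈B} f∘θ_x) ≤ #B · Σ_v |cov_μ(f, f∘θ_v)|`. [folklore] -/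
theorem variance_boxSum_le {μ : Measure (LGConfig d G)} [IsProbabilityMeasure μ] (hμ : IsZdTranslationInvariant μ)
    {f : LGConfig d G → ℝ} (hfm : Measurable f) {M : ℝ} (hfb : ∀ U, |f U| ≤ M)
    (hsum : Summable fun v : Site d => |cov[f, fun U => f (configShift v U); μ]|) (B : Finset (Site d)) :
    Var[fun U => ∑ x ∈ B, f (configShift x U); μ] ≤ B.card * ∑' v, |cov[f, fun U => f (configShift v U); μ]| := by
  classical
  set c : Site d → ℝ := fun v => cov[f, fun U => f (configShift v U); μ] with hc
  set Fx : Site d → LGConfig d G → ℝ := fun x U => f (configShift x U) with hFx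
  have hmem : ∀ x : Site d, MemLp (Fx x) 2 μ := fun x =>
    memLp_of_bounded (a := -M) (b := M) (ae_of_all _ fun U => by
        simp only [Set.mem_Icc]; exact abs_le.1 (hfb _))
      (hfm.comp (configShift x).measurable).aestronglyMeasurable 2
  -- translation invariance: `cov(f∘θ_x, f∘θ_y) = c(y − x)` (the tree's shift composition law inlined)
  have hshift : ∀ x y : Site d, cov[Fx x, Fx y; μ] = c (y - x) := by
    intro x y
    have hcomp : Fx y = fun U => f (configShift (y - x) (configShift x U)) := by
      funext U
      simp only [hFx]
      congr 1
      funext e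
      simp only [configShift_apply]
      congr 1
      ext <;> simp [sub_sub]
    rw [hcomp]
    have h := covariance_map_equiv (μ := μ) f (fun U => f (configShift (y - x) U)) (configShift x)
    rw [hμ x] at h
    exact h.symm
  have hsumB : (fun U => ∑ x ∈ B, f (configShift x U)) = ∑ x ∈ B, Fx x := by funext U; simp [hFx]
  rw [hsumB, ← covariance_self (memLp_finsetSum' B fun x _ => hmem x).aestronglyMeasurable.aemeasurable,
    covariance_sum_sum' (fun x _ => hmem x) (fun y _ => hmem y)]
  -- each row is bounded by the full autocovariance series
  have hrow : ∀ x ∈ B, ∑ y ∈ B, cov[Fx x, Fx y; μ] ≤ ∑' v, |c v| := by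
    intro x _
    have hinj : Set.InjOn (fun y : Site d => y - x) ↑B := fun a _ b _ h => sub_left_injective h
    calc ∑ y ∈ B, cov[Fx x, Fx y; μ] = ∑ y ∈ B, c (y - x) := Finset.sum_congr rfl fun y _ => hshift x y
      _ ≤ ∑ y ∈ B, |c (y - x)| := Finset.sum_le_sum fun y _ => le_abs_self _
      _ = ∑ v ∈ B.image (fun y => y - x), |c v| := by rw [Finset.sum_image hinj]
      _ ≤ ∑' v, |c v| := (hsum.sum_le_tsum _ fun _ _ => abs_nonneg _)
  calc ∑ x ∈ B, ∑ y ∈ B, cov[Fx x, Fx y; μ] ≤ ∑ _x ∈ B, ∑' v, |c v| := Finset.sum_le_sum hrow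
    _ = B.card * ∑' v, |c v| := by rw [Finset.sum_const, nsmul_eq_mul]

/-! ### Chebyshev: the mean ergodic theorem with a rate -/

/-- ★ **CHEBYSHEV FOR BLOCK AVERAGES**: for a translation-invariant probability measure, a bounded measurable `f` with absolutely
summable autocovariance, every finite nonempty `B` and every `ε > 0`:
`μ{U : ε ≤ |#B⁻¹ Σ_{x∈B} f(θ_x U) − ∫ f dμ|} ≤ (Σ_v |cov_μ(f, f∘θ_v)|) / (ε² #B)`. [folklore] -/
theorem measure_abs_boxAverage_sub_ge_le {μ : Measure (LGConfig d G)} [IsProbabilityMeasure μ]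
    (hμ : IsZdTranslationInvariant μ) {f : LGConfig d G → ℝ} (hfm : Measurable f) {M : ℝ} (hfb : ∀ U, |f U| ≤ M)
    (hsum : Summable fun v : Site d => |cov[f, fun U => f (configShift v U); μ]|) {B : Finset (Site d)}
    (hB : B.Nonempty) {ε : ℝ} (hε : 0 < ε) :
    μ {U | ε ≤ |(∑ x ∈ B, f (configShift x U)) / B.card - ∫ U', f U' ∂μ|} ≤
      ENNReal.ofReal ((∑' v, |cov[f, fun U => f (configShift v U); μ]|) / (ε ^ 2 * B.card)) := by
  classical
  have hBpos : (0 : ℝ) < B.card := by exact_mod_cast hB.card_pos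
  set X : LGConfig d G → ℝ := fun U => (∑ x ∈ B, f (configShift x U)) / B.card with hX
  have hSm : Measurable fun U => ∑ x ∈ B, f (configShift x U) :=
    Finset.measurable_sum _ fun x _ => hfm.comp (configShift x).measurable
  have hSb : ∀ U, |∑ x ∈ B, f (configShift x U)| ≤ B.card * M := fun U =>
    (Finset.abs_sum_le_sum_abs _ _).trans (by
      calc ∑ x ∈ B, |f (configShift x U)| ≤ ∑ _x ∈ B, M := Finset.sum_le_sum fun x _ => hfb _
        _ = B.card * M := by rw [Finset.sum_const, nsmul_eq_mul])
  have hXb : ∀ U, |X U| ≤ B.card * M / B.card := fun U => by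
    simp only [hX]
    rw [abs_div, abs_of_pos hBpos]
    exact div_le_div_of_nonneg_right (hSb U) hBpos.le
  have hXmem : MemLp X 2 μ :=
    memLp_of_bounded (a := -(B.card * M / B.card)) (b := B.card * M / B.card)
      (ae_of_all _ fun U => by simp only [Set.mem_Icc]; exact abs_le.1 (hXb U))
      (hSm.div_const _).aestronglyMeasurable 2
  -- the mean of the block average is `∫ f dμ`
  have hmean : μ[X] = ∫ U', f U' ∂μ := by
    simp only [hX]
    rw [integral_div, integral_finsetSum _ fun x _ => ?_]
    · simp_rw [integral_comp_shift hμ f]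
      rw [Finset.sum_const, nsmul_eq_mul, mul_div_cancel_left₀ _ hBpos.ne']
    · exact (integrable_of_abs_le' (hfm.comp (configShift x).measurable) fun U => hfb _)
  -- the variance of the block average
  have hvar : Var[X; μ] ≤ (∑' v, |cov[f, fun U => f (configShift v U); μ]|) / B.card := by
    have h1 : Var[X; μ] = Var[fun U => ∑ x ∈ B, f (configShift x U); μ] / (B.card : ℝ) ^ 2 := by
      simp only [hX, div_eq_mul_inv]
      rw [show (fun U => (∑ x ∈ B, f (configShift x U)) * ((B.card : ℝ))⁻¹) =
          fun U => ((B.card : ℝ))⁻¹ * ∑ x ∈ B, f (configShift x U) from funext fun U => mul_comm _ _]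
      rw [variance_const_mul, inv_pow]
      ring
    rw [h1, div_le_div_iff₀ (by positivity) hBpos]
    calc Var[fun U => ∑ x ∈ B, f (configShift x U); μ] * B.card
        ≤ (B.card * ∑' v, |cov[f, fun U => f (configShift v U); μ]|) * B.card :=
          mul_le_mul_of_nonneg_right (variance_boxSum_le hμ hfm hfb hsum B) hBpos.le
      _ = (∑' v, |cov[f, fun U => f (configShift v U); μ]|) * (B.card : ℝ) ^ 2 := by ring
  have key := meas_ge_le_variance_div_sq hXmem hε
  rw [hmean] at key
  refine key.trans (ENNReal.ofReal_le_ofReal ?_)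
  rw [div_le_div_iff₀ (by positivity) (by positivity)]
  calc Var[X; μ] * (ε ^ 2 * B.card) = (Var[X; μ] * B.card) * ε ^ 2 := by ring
    _ ≤ (∑' v, |cov[f, fun U => f (configShift v U); μ]|) * ε ^ 2 := by
        refine mul_le_mul_of_nonneg_right ?_ (by positivity)
        rwa [le_div_iff₀ hBpos] at hvar

/-! ### The almost-sure ergodic theorem along cubes (`d ≥ 2`) -/

/-- `#B_n = (2n+1)^d` (real-cast form). [folklore] -/
theorem card_siteBox_cast (d n : ℕ) : ((siteBox d n).card : ℝ) = (2 * (n : ℝ) + 1) ^ d := by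
  have h : (siteBox d n).card = (2 * n + 1) ^ d := by
    rw [siteBox, Fintype.card_piFinset]
    simp only [Int.card_Icc, Finset.prod_const, Finset.card_univ, Fintype.card_fin]
    congr 1
    have h : ((n : ℤ) + 1 - -(n : ℤ)) = ((2 * n + 1 : ℕ) : ℤ) := by push_cast; ring
    rw [h, Int.toNat_natCast]
  rw [h]; push_cast; ring

/-- The origin lies in every centred box. [folklore] -/
theorem siteBox_nonempty (d n : ℕ) : (siteBox d n).Nonempty :=
  ⟨0, by rw [mem_siteBox_iff_norm, norm_zero]; exact Nat.cast_nonneg n⟩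

/-- ★★ **THE ALMOST-SURE ERGODIC THEOREM ALONG CUBES** (`d ≥ 2`): for a translation-invariant probability measure `μ` on the `ℤ^d`
link configurations and a bounded measurable `f` with absolutely summable autocovariance, the cube averages converge to the mean
for `μ`-almost every configuration: `#B_n⁻¹ Σ_{x∈B_n} f(θ_x U) → ∫ f dμ` a.s. (Chebyshev `≤ Σ|c|·(m+1)²/(2n+1)^d`, summable in `n`
for `d ≥ 2`, Borel–Cantelli for each tolerance `1/(m+1)`, intersection over `m`). [folklore] -/
theorem ae_tendsto_boxAverage (hd : 2 ≤ d) {μ : Measure (LGConfig d G)} [IsProbabilityMeasure μ]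
    (hμ : IsZdTranslationInvariant μ) {f : LGConfig d G → ℝ} (hfm : Measurable f) {M : ℝ} (hfb : ∀ U, |f U| ≤ M)
    (hsum : Summable fun v : Site d => |cov[f, fun U => f (configShift v U); μ]|) :
    ∀ᵐ U ∂μ, Tendsto (fun n : ℕ => (∑ x ∈ siteBox d n, f (configShift x U)) / (siteBox d n).card) atTop
      (𝓝 (∫ U', f U' ∂μ)) := by
  set A : ℝ := ∑' v, |cov[f, fun U => f (configShift v U); μ]| with hA
  have hA0 : 0 ≤ A := tsum_nonneg fun _ => abs_nonneg _
  -- for each tolerance `1/(m+1)`: almost surely the deviation is eventually below it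
  have hstep : ∀ m : ℕ, ∀ᵐ U ∂μ, ∀ᶠ n in atTop,
      U ∉ {U | (1 : ℝ) / (m + 1) ≤ |(∑ x ∈ siteBox d n, f (configShift x U)) / (siteBox d n).card - ∫ U', f U' ∂μ|} := by
    intro m
    apply ae_eventually_notMem
    have hε : (0 : ℝ) < 1 / (m + 1) := by positivity
    -- the Chebyshev bounds and their summable majorant `A (m+1)² / (n+1)²`
    set g : ℕ → ℝ := fun n => A * ((m : ℝ) + 1) ^ 2 * (1 / ((n : ℝ) + 1) ^ 2) with hg
    have hg0 : ∀ n, 0 ≤ g n := fun n => by positivity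
    have hgs : Summable g := by
      have h1 : Summable fun n : ℕ => 1 / ((n : ℝ) + 1) ^ 2 := by
        have h := (summable_nat_add_iff 1).2 (Real.summable_one_div_nat_pow.2 one_lt_two)
        simpa [Nat.cast_add, Nat.cast_one] using h
      exact h1.mul_left _
    have hle : ∀ n, μ {U | (1 : ℝ) / (m + 1) ≤
        |(∑ x ∈ siteBox d n, f (configShift x U)) / (siteBox d n).card - ∫ U', f U' ∂μ|} ≤ ENNReal.ofReal (g n) := by
      intro n
      refine (measure_abs_boxAverage_sub_ge_le hμ hfm hfb hsum (siteBox_nonempty d n) hε).trans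
        (ENNReal.ofReal_le_ofReal ?_)
      rw [card_siteBox_cast]
      have hn1 : (0 : ℝ) < (n : ℝ) + 1 := by positivity
      have hpow : ((n : ℝ) + 1) ^ 2 ≤ (2 * (n : ℝ) + 1) ^ d := by
        calc ((n : ℝ) + 1) ^ 2 ≤ (2 * (n : ℝ) + 1) ^ 2 := by gcongr; linarith
          _ ≤ (2 * (n : ℝ) + 1) ^ d := pow_le_pow_right₀ (by linarith) hd
      rw [hg, div_le_iff₀ (by positivity)]
      calc A = A * ((m : ℝ) + 1) ^ 2 * (1 / ((n : ℝ) + 1) ^ 2) * ((1 / ((m : ℝ) + 1)) ^ 2 * ((n : ℝ) + 1) ^ 2) := by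
            field_simp
        _ ≤ A * ((m : ℝ) + 1) ^ 2 * (1 / ((n : ℝ) + 1) ^ 2) * ((1 / ((m : ℝ) + 1)) ^ 2 * (2 * (n : ℝ) + 1) ^ d) := by
            gcongr
    refine ne_top_of_le_ne_top ?_ (ENNReal.tsum_le_tsum hle)
    rw [← ENNReal.ofReal_tsum_of_nonneg hg0 hgs]
    exact ENNReal.ofReal_ne_top
  have hall : ∀ᵐ U ∂μ, ∀ m : ℕ, ∀ᶠ n in atTop,
      |(∑ x ∈ siteBox d n, f (configShift x U)) / (siteBox d n).card - ∫ U', f U' ∂μ| < (1 : ℝ) / (m + 1) := by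
    rw [ae_all_iff]
    intro m
    filter_upwards [hstep m] with U hU
    exact hU.mono fun n hn => not_le.1 hn
  filter_upwards [hall] with U hU
  rw [Metric.tendsto_atTop]
  intro ε hε
  obtain ⟨m, hm⟩ := exists_nat_one_div_lt hε
  obtain ⟨N, hN⟩ := eventually_atTop.1 (hU m)
  exact ⟨N, fun n hn => by rw [Real.dist_eq]; exact (hN n hn).trans hm⟩

/-! ### The `SU(2)` cell in the vertex-star window -/

/-- ★★ **CELL — ALMOST-SURE SELF-AVERAGING FOR `SU(2)` LATTICE YANG–MILLS ON `ℤ⁴`, `|β_W| ≤ 9/25`** (tree coupling `b`,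
`|b| ≤ 9/50`; the unique DLR state `μ` is translation invariant — `su2_wilson_oneState_translationInvariant` — and massive —
`isMassiveState_of_massGapAt` + `su2_massGapAt_of_abs_le`): for EVERY bounded measurable gauge-invariant local observable `F`
(e.g. the plaquette `½ Re tr U_p`), for `μ`-almost every configuration `U` the cube averages `#B_n⁻¹ Σ_{x∈B_n} F(θ_x U)` converge
to `⟨F⟩_μ`, and `μ{|#B⁻¹ Σ_{x∈B} F∘θ_x − ⟨F⟩| ≥ ε} ≤ C_F/(ε² #B)` for every finite nonempty `B`. [folklore] -/
theorem su2_wilson_ae_tendsto_boxAverage {b : ℝ} (hb : |b| ≤ 9 / 50) :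
    ∃ μ : Measure (LGConfig 4 (Matrix.specialUnitaryGroup (Fin 2) ℂ)),
      ymGibbsMeasures (d := 4) (fundamentalRep (Fin 2)) b = {μ} ∧
      ∀ F : LGConfig 4 (Matrix.specialUnitaryGroup (Fin 2) ℂ) → ℝ,
        Literature.MathematicalPhysics.QuantumLattice.IsLocalObservable F → Measurable F → (∃ C, ∀ U, |F U| ≤ C) →
        IsZdGaugeInvariant F →
          (∀ᵐ U ∂μ, Tendsto (fun n : ℕ => (∑ x ∈ siteBox 4 n, F (configShift x U)) / (siteBox 4 n).card) atTop
            (𝓝 (∫ U', F U' ∂μ))) ∧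
          ∃ C : ℝ, ∀ (B : Finset (Site 4)), B.Nonempty → ∀ ε : ℝ, 0 < ε →
            μ {U | ε ≤ |(∑ x ∈ B, F (configShift x U)) / B.card - ∫ U', F U' ∂μ|} ≤
              ENNReal.ofReal (C / (ε ^ 2 * B.card)) := by
  obtain ⟨μ, hG, hinv⟩ := su2_wilson_oneState_translationInvariant hb
  have hμ : μ ∈ ymGibbsMeasures (d := 4) (fundamentalRep (Fin 2)) b := by rw [hG]; exact Set.mem_singleton μ
  have hb' : |b / 2| ≤ 9 / 100 := by rw [abs_div, abs_two]; linarith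
  have hμ2 : μ ∈ ymGibbsMeasures (d := 4) (fundamentalRep (Fin 2)) (((2 : ℕ) : ℝ) * (b / 2)) := by
    have e : (((2 : ℕ) : ℝ) * (b / 2)) = b := by push_cast; ring
    rw [e]; exact hμ
  have hmass : IsMassiveState μ :=
    Summit.Ventures.YMGap.MassGapMassive.isMassiveState_of_massGapAt (N := 2) (by norm_num)
      (ImprovedThresholdStar.su2_massGapAt_of_abs_le hb') μ hμ2
  have hμG : IsGibbsMeasure (ymSpecification (d := 4) (fundamentalRep (Fin 2)) b) μ := hμ
  haveI := hμG.isProbabilityMeasure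
  refine ⟨μ, hG, fun F hloc hFm hFb hFg => ?_⟩
  obtain ⟨m, hm⟩ := hmass
  obtain ⟨hm0, C, hC⟩ := hm F F hloc hloc hFm hFm hFb hFb hFg hFg
  obtain ⟨M, hM⟩ := hFb
  -- absolute summability of the autocovariance from the `ℓ^∞` exponential decay rate (rb-p1's `ℓ¹` lattice sum)
  have hs : Summable fun v : Site 4 => |cov[F, fun U => F (configShift v U); μ]| := by
    set r : ℝ := exp (-(m / 4)) with hr
    have hr0 : 0 ≤ r := (exp_pos _).le
    have hr1 : r < 1 := Real.exp_lt_one_iff.2 (neg_neg_of_pos (by positivity))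
    refine Summable.of_nonneg_of_le (fun v => abs_nonneg _) (fun v => ?_)
      (((summable_pow_l1_sub hr0 hr1 (0 : Site 4)).1).mul_left (max C 0))
    rw [zero_sub, l1_neg]
    have h3 : exp (-m * ‖v‖) ≤ r ^ l1 v := by
      rw [hr, ← Real.exp_nat_mul]
      refine exp_le_exp.2 ?_
      have hl : (l1 v : ℝ) ≤ (4 : ℕ) * ‖v‖ := l1_le_mul_norm v
      have : (l1 v : ℝ) * (m / 4) ≤ m * ‖v‖ := by
        rw [mul_div_assoc', div_le_iff₀ (by norm_num : (0 : ℝ) < 4)]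
        push_cast at hl
        nlinarith
      linarith
    calc |cov[F, fun U => F (configShift v U); μ]| ≤ C * exp (-m * ‖v‖) := hC v
      _ ≤ max C 0 * exp (-m * ‖v‖) := mul_le_mul_of_nonneg_right (le_max_left _ _) (exp_pos _).le
      _ ≤ max C 0 * r ^ l1 v := mul_le_mul_of_nonneg_left h3 (le_max_right _ _)
  exact ⟨ae_tendsto_boxAverage (d := 4) (by norm_num) hinv hFm hM hs,
    ⟨∑' v, |cov[F, fun U => F (configShift v U); μ]|, fun B hB ε hε =>
      measure_abs_boxAverage_sub_ge_le hinv hFm hM hs hB hε⟩⟩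

end ErgodicAverages

end Summit.Ventures.YMGap.RobustBall

end
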